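import Literature.Probability.Percolation.AltFourArmOfInterfaces
import Literature.Probability.Percolation.CLE6RerootSaturated
import HarnessLib

/-!
# Two crossing interface loops force four alternating arms (rebasing the loops)

Topic: Probability / Percolation. Proof-only companion of `AltFourArmOfInterfaces.lean` (three
shell traversals by interface loops, counted as Aizenman–Burchard's separate segments in time,
force `altFourArm`), serving the named fact `Literature.Probability.Percolation.fourArm_exponent`
(Smirnov–Werner 2001, Thm. 4, `j = 4`) through the loop route to its continuum input (16)₄. A
closed lattice loop whose TRACE meets both `{|z| ≤ ρ}` and `{|z| ≥ R}` crosses the shell twice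
geometrically, but as a curve based at an arbitrary vertex it is traversed once or twice; based at
a vertex outside the shell it is traversed twice. Since every vertex-rebasing of an interface loop
is an interface loop of the same configuration with the same trace (`IsSiteInterfaceLoop.rotateAt`,
`CLE6RerootSaturated.lean`; Camia–Newman 2006, §2: a lattice loop enters the collection once per
base point), the dictionary takes its natural trace-level form for two loops:

* `SimpleGraph.Walk.getVert_rotateAt`, `polyPt_rotateAt_of_lt`, `polyPt_rotateAt_of_le`,
  `polyTrace_rotateAt` — vertices and trace of the rotated walk;
* `IsSiteInterfaceLoop.exists_vertexTraversals_rotateAt` — **rebasing at an outer vertex gives two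
  separated vertex traversals**: if vertex `i` is within `ρ` and vertex `j` beyond `R` of the
  origin (`ρ + 4δ < R`), the walk rotated at `j` has vertex traversals `(1, i')` (inwards) and
  `(i' + 1, n - 1)` (outwards), `2 ≤ i' ≤ n - 3`, of the shell `{ρ + 2δ ≤ |z| ≤ R - 2δ}`;
* `mem_altFourArm_of_two_crossing_traces` — **two interface loops with disjoint traces, each of
  whose traces meets `{|z| ≤ ρ}` and `{|z| ≥ R}`, force `ω ∈ altFourArm r₁ r₂`** for the
  hexagonal annuli well inside (`mem_altFourArm_of_vertexTraversals` for the two rebased loops,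
  `2 + 2 ≥ 3` traversals);
* `mem_altFourArm_of_hasTraversals_one_one` — the same from one traversal in time of each loop.

Everything is proved; no definitions and no named facts are introduced.

## References

* S. Smirnov, W. Werner, Math. Res. Lett. 8 (2001), §4, Remark 6 and (15) [SmirnovWernerMRL2001].
* C. Garban, G. Pete, O. Schramm, J. Amer. Math. Soc. 26 (2013), §2.4 [GarbanPeteSchramm2013Pivotal].
* F. Camia, C. M. Newman, Comm. Math. Phys. 268 (2006), §2, §4 [CamiaNewman2006].
* M. Aizenman, A. Burchard, Duke Math. J. 99 (1999), Appendix A [AizenmanBurchardDuke1999].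

Tree: `SimpleGraph.Walk.rotateAt`, `IsSiteInterfaceLoop.rotateAt`, `length_rotateAt`
(`CLE6RerootSaturated.lean`), `mem_altFourArm_of_vertexTraversals`
(`AltFourArmOfInterfaces.lean`), `IsSiteInterfaceLoop.dist_polyPt_leftPt_le`, `mem_polyTrace_iff`,
`IsSiteInterfaceLoop.polyPiece_subset_closedBall`. Mathlib: `SimpleGraph.Walk.getVert_append`,
`drop_getVert`, `take_getVert`, `drop_length`, `take_length`.
-/

noncomputable section

open Set Metric Complex Filter MeasureTheory
open Literature.Topology.PlaneTopology Literature.Probability.RandomPlanarGeometry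
open scoped unitInterval Topology

/-! ### Vertices and trace of the rotated walk -/

namespace SimpleGraph.Walk

variable {V : Type*} {G : SimpleGraph V} {v : V}

/-- **Vertices of the rotated walk**: vertex `i` of `w.rotateAt k` is vertex `k + i` of `w` while
`i < n - k`, and vertex `i - (n - k)` (capped at `k`) afterwards. [folklore] -/
theorem getVert_rotateAt (w : G.Walk v v) (k i : ℕ) :
    (w.rotateAt k).getVert i =
      if i < w.length - k then w.getVert (k + i) else w.getVert (min k (i - (w.length - k))) := by
  rw [rotateAt, getVert_append, drop_length, drop_getVert, take_getVert]

end SimpleGraph.Walk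

namespace Literature.Probability.Percolation

open LatticeModels

section Rotate

variable {f₀ : HexVertex} (δ : ℝ) (w : hexGraph.Walk f₀ f₀)

/-- Vertices of the polygon of the rotated walk, first stretch: `polyPt (w.rotateAt k) i =
polyPt w (k + i)` for `i < n - k`. [folklore] -/
theorem polyPt_rotateAt_of_lt (k : ℕ) {i : ℕ} (hi : i < w.length - k) :
    polyPt δ (w.rotateAt k) i = polyPt δ w (k + i) := by
  rw [polyPt, polyPt, SimpleGraph.Walk.getVert_rotateAt w k, if_pos hi]

/-- Vertices of the polygon of the rotated walk, second stretch: `polyPt (w.rotateAt k) i =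
polyPt w (i - (n - k))` for `n - k ≤ i ≤ n`. [folklore] -/
theorem polyPt_rotateAt_of_le {k : ℕ} (hk : k ≤ w.length) {i : ℕ} (hi : w.length - k ≤ i) (hin : i ≤ w.length) :
    polyPt δ (w.rotateAt k) i = polyPt δ w (i - (w.length - k)) := by
  rw [polyPt, polyPt, SimpleGraph.Walk.getVert_rotateAt w k, if_neg (not_lt.2 hi), Nat.min_eq_right (by omega)]

/-- The base vertex is vertex `0` and vertex `n` of the polygon. [folklore] -/
theorem polyPt_zero_eq_polyPt_length : polyPt δ w 0 = polyPt δ w w.length := by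
  simp [polyPt]

/-- **The rotated walk has the same trace.** [folklore] -/
theorem polyTrace_rotateAt {k : ℕ} (hk : k ≤ w.length) : polyTrace δ (w.rotateAt k) = polyTrace δ w := by
  have hlen := SimpleGraph.Walk.length_rotateAt w hk
  have h0n := polyPt_zero_eq_polyPt_length δ w
  -- piece `i` of the rotation is piece `k + i` or piece `i - (n - k)` of `w`
  have hpiece : ∀ i, i < w.length → ∃ j, j < w.length ∧ polyPiece δ (w.rotateAt k) i = polyPiece δ w j := by
    intro i hi
    by_cases h1 : i + 1 < w.length - k
    · refine ⟨k + i, by omega, ?_⟩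
      rw [polyPiece, polyPiece, polyPt_rotateAt_of_lt δ w k (by omega), polyPt_rotateAt_of_lt δ w k h1]
      rfl
    · by_cases h2 : i < w.length - k
      · -- `i = n - k - 1`: the piece into the old base vertex `v_n = v_0`
        refine ⟨k + i, by omega, ?_⟩
        rw [polyPiece, polyPiece, polyPt_rotateAt_of_lt δ w k h2,
          polyPt_rotateAt_of_le δ w hk (by omega) (by omega)]
        have e1 : i + 1 - (w.length - k) = 0 := by omega
        have e2 : k + i + 1 = w.length := by omega
        rw [e1, e2, h0n]
      · refine ⟨i - (w.length - k), by omega, ?_⟩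
        rw [polyPiece, polyPiece, polyPt_rotateAt_of_le δ w hk (by omega) (by omega),
          polyPt_rotateAt_of_le δ w hk (by omega) (by omega)]
        have e : i + 1 - (w.length - k) = i - (w.length - k) + 1 := by omega
        rw [e]
  have hpiece' : ∀ j, j < w.length → ∃ i, i < w.length ∧ polyPiece δ w j = polyPiece δ (w.rotateAt k) i := by
    intro j hj
    by_cases h1 : k ≤ j
    · -- `j = k + i` with `i < n - k`
      by_cases h2 : j + 1 < w.length
      · refine ⟨j - k, by omega, ?_⟩
        rw [polyPiece, polyPiece, polyPt_rotateAt_of_lt δ w k (by omega), polyPt_rotateAt_of_lt δ w k (by omega)]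
        have e1 : k + (j - k) = j := by omega
        have e2 : k + (j - k + 1) = j + 1 := by omega
        rw [e1, e2]
      · -- `j = n - 1`
        refine ⟨j - k, by omega, ?_⟩
        rw [polyPiece, polyPiece, polyPt_rotateAt_of_lt δ w k (by omega),
          polyPt_rotateAt_of_le δ w hk (by omega) (by omega)]
        have e1 : k + (j - k) = j := by omega
        have e2 : j - k + 1 - (w.length - k) = 0 := by omega
        have e3 : j + 1 = w.length := by omega
        rw [e1, e2, e3, h0n]
    · refine ⟨j + (w.length - k), by omega, ?_⟩
      rw [polyPiece, polyPiece, polyPt_rotateAt_of_le δ w hk (by omega) (by omega),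
        polyPt_rotateAt_of_le δ w hk (by omega) (by omega)]
      have e1 : j + (w.length - k) - (w.length - k) = j := by omega
      have e2 : j + (w.length - k) + 1 - (w.length - k) = j + 1 := by omega
      rw [e1, e2]
  ext z
  simp only [mem_polyTrace_iff, hlen]
  constructor
  · rintro ⟨i, hi, hz⟩
    obtain ⟨j, hj, hij⟩ := hpiece i hi
    exact ⟨j, hj, hij ▸ hz⟩
  · rintro ⟨j, hj, hz⟩
    obtain ⟨i, hi, hji⟩ := hpiece' j hj
    exact ⟨i, hi, hji ▸ hz⟩

end Rotate

/-! ### Rebasing at an outer vertex -/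

section OneLoop

variable {ω : SiteConfig (Site 2)} {f₀ : HexVertex} {w : hexGraph.Walk f₀ f₀}
  (hw : IsSiteInterfaceLoop ω w) {δ : ℝ} (hδ : 0 < δ)

include hw hδ

/-- Consecutive vertices of the polygon of an interface loop are within `2δ` (both are within `δ`
of the left point of the dart between them). [folklore] -/
theorem IsSiteInterfaceLoop.dist_polyPt_succ_le {i : ℕ} (hi : i < w.length) :
    dist (polyPt δ w i) (polyPt δ w (i + 1)) ≤ 2 * δ := by
  obtain ⟨h1, h2⟩ := hw.dist_polyPt_leftPt_le hδ.le hi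
  linarith [dist_triangle (polyPt δ w i) (hw.leftPt δ i) (polyPt δ w (i + 1)), dist_comm (hw.leftPt δ i) (polyPt δ w (i + 1))]

/-- Vertices `a ≤ b` of the polygon are within `2δ (b - a)`. [folklore] -/
theorem IsSiteInterfaceLoop.dist_polyPt_le_mul {a b : ℕ} (hab : a ≤ b) (hb : b ≤ w.length) :
    dist (polyPt δ w a) (polyPt δ w b) ≤ 2 * δ * (b - a : ℕ) := by
  obtain ⟨m, rfl⟩ : ∃ m, b = a + m := ⟨b - a, by omega⟩
  rw [Nat.add_sub_cancel_left]
  induction m with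
  | zero => simp
  | succ m ih =>
    have h1 := ih (by omega) (by omega)
    have h2 := hw.dist_polyPt_succ_le hδ (i := a + m) (by omega)
    rw [show a + (m + 1) = a + m + 1 by omega]
    push_cast at h1 ⊢
    linarith [dist_triangle (polyPt δ w a) (polyPt δ w (a + m)) (polyPt δ w (a + m + 1))]

/-- Vertices `i`, `j` of the polygon are within `2δ ((n - i) + j)` (going through the base vertex
`v_n = v_0`). [folklore] -/
theorem IsSiteInterfaceLoop.dist_polyPt_le_mul_cyclic {i j : ℕ} (hi : i ≤ w.length) (hj : j ≤ w.length) :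
    dist (polyPt δ w i) (polyPt δ w j) ≤ 2 * δ * ((w.length - i + j : ℕ) : ℝ) := by
  have h0n : polyPt δ w 0 = polyPt δ w w.length := by
    rw [polyPt, polyPt, SimpleGraph.Walk.getVert_zero, SimpleGraph.Walk.getVert_length]
  have h1 := hw.dist_polyPt_le_mul hδ hi le_rfl
  have h2 := hw.dist_polyPt_le_mul hδ (Nat.zero_le j) hj
  rw [h0n, Nat.sub_zero] at h2
  push_cast [hi] at h1 h2 ⊢
  linarith [dist_triangle (polyPt δ w i) (polyPt δ w w.length) (polyPt δ w j)]

/-- **A trace point of the polygon is within `2δ` of a vertex.** [folklore] -/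
theorem IsSiteInterfaceLoop.exists_polyPt_dist_le_of_mem_polyTrace {z : ℂ} (hz : z ∈ polyTrace δ w) :
    ∃ i, i < w.length ∧ dist z (polyPt δ w i) ≤ 2 * δ := by
  obtain ⟨i, hi, hzi⟩ := mem_polyTrace_iff.1 hz
  refine ⟨i, hi, ?_⟩
  have h1 := hw.polyPiece_subset_closedBall hδ.le hi hzi
  have h2 := (hw.dist_polyPt_leftPt_le hδ.le hi).1
  rw [mem_closedBall] at h1
  linarith [dist_triangle z (hw.leftPt δ i) (polyPt δ w i), dist_comm (hw.leftPt δ i) (polyPt δ w i)]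

/-- **Rebasing at an outer vertex gives two separated vertex traversals.** If vertex `i` of the
polygon is within `ρ` of `x` and vertex `j` (`1 ≤ j ≤ n`) is at distance `≥ R` from `x`, with
`ρ + 4δ < R`, then the walk rotated at `j` (an interface loop of the same configuration with the
same trace) has, for some `2 ≤ i' ≤ n - 3`, its vertex `i'` within `ρ` of `x`, its vertices `1`
and `n - 1` at distance `≥ R - 2δ`, and its vertex `i' + 1` within `ρ + 2δ`: the vertex
traversals `(1, i')` inwards and `(i' + 1, n - 1)` outwards. [folklore] -/
theorem IsSiteInterfaceLoop.exists_vertexTraversals_rotateAt {x : ℂ} {ρ R : ℝ} (hρR : ρ + 4 * δ < R)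
    {i₀ j : ℕ} (hi₀ : i₀ ≤ w.length) (hj1 : 1 ≤ j) (hj : j ≤ w.length)
    (hin₀ : dist (polyPt δ w i₀) x ≤ ρ) (hout : R ≤ dist (polyPt δ w j) x) :
    ∃ i' : ℕ, 2 ≤ i' ∧ i' + 3 ≤ w.length ∧
      dist (polyPt δ (w.rotateAt j) i') x ≤ ρ ∧
      R - 2 * δ ≤ dist (polyPt δ (w.rotateAt j) 1) x ∧
      R - 2 * δ ≤ dist (polyPt δ (w.rotateAt j) (w.length - 1)) x ∧
      dist (polyPt δ (w.rotateAt j) (i' + 1)) x ≤ ρ + 2 * δ := by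
  have hlen : 3 ≤ w.length := hw.three_le_length
  have h0n := polyPt_zero_eq_polyPt_length δ w
  -- normalise the inner vertex index to `i < n`
  obtain ⟨i, hi, hin⟩ : ∃ i, i < w.length ∧ dist (polyPt δ w i) x ≤ ρ := by
    rcases Nat.lt_or_ge i₀ w.length with h | h
    · exact ⟨i₀, h, hin₀⟩
    · have e : i₀ = w.length := le_antisymm hi₀ h
      refine ⟨0, by omega, ?_⟩
      rw [h0n, ← e]; exact hin₀
  -- far apart vertices are far apart in index, also cyclically
  have hfar : 4 * δ < dist (polyPt δ w i) (polyPt δ w j) := by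
    have := dist_triangle (polyPt δ w j) (polyPt δ w i) x
    rw [dist_comm (polyPt δ w j) (polyPt δ w i)] at this
    linarith
  -- vertex `1` of the rotation is within `2δ` of vertex `j`, vertex `n - 1` too
  have hv1 : R - 2 * δ ≤ dist (polyPt δ (w.rotateAt j) 1) x := by
    by_cases hjn : j + 1 < w.length
    · rw [polyPt_rotateAt_of_lt δ w j (by omega)]
      have := hw.dist_polyPt_succ_le hδ (i := j) (by omega)
      linarith [dist_triangle (polyPt δ w j) (polyPt δ w (j + 1)) x, dist_comm (polyPt δ w j) (polyPt δ w (j + 1))]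
    · rw [polyPt_rotateAt_of_le δ w hj (by omega) (by omega)]
      rcases (by omega : j = w.length ∨ j + 1 = w.length) with e | e
      · rw [show 1 - (w.length - j) = 1 by omega]
        have := hw.dist_polyPt_succ_le hδ (i := 0) (by omega)
        rw [h0n, ← e] at this
        linarith [dist_triangle (polyPt δ w j) (polyPt δ w 1) x, dist_comm (polyPt δ w j) (polyPt δ w 1)]
      · rw [show 1 - (w.length - j) = 0 by omega, h0n, ← e]
        have := hw.dist_polyPt_succ_le hδ (i := j) (by omega)
        linarith [dist_triangle (polyPt δ w j) (polyPt δ w (j + 1)) x, dist_comm (polyPt δ w j) (polyPt δ w (j + 1))]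
  have hvn : R - 2 * δ ≤ dist (polyPt δ (w.rotateAt j) (w.length - 1)) x := by
    rw [polyPt_rotateAt_of_le δ w hj (by omega) (by omega), show w.length - 1 - (w.length - j) = j - 1 by omega]
    have := hw.dist_polyPt_succ_le hδ (i := j - 1) (by omega)
    rw [show j - 1 + 1 = j by omega] at this
    linarith [dist_triangle (polyPt δ w j) (polyPt δ w (j - 1)) x, dist_comm (polyPt δ w (j - 1)) (polyPt δ w j)]
  by_cases hij : j ≤ i
  · -- `i' = i - j`, in the first stretch
    have hgoal2 : i - j + 3 ≤ w.length := by
      by_contra h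
      have h1 := hw.dist_polyPt_le_mul_cyclic hδ hi.le hj
      have h2 : ((w.length - i + j : ℕ) : ℝ) ≤ 2 := by exact_mod_cast (by omega : w.length - i + j ≤ 2)
      nlinarith
    refine ⟨i - j, ?_, hgoal2, ?_, hv1, hvn, ?_⟩
    · by_contra h
      have h1 := hw.dist_polyPt_le_mul hδ hij hi.le
      have h2 : ((i - j : ℕ) : ℝ) ≤ 1 := by exact_mod_cast (by omega : i - j ≤ 1)
      rw [dist_comm] at hfar
      nlinarith
    · rw [polyPt_rotateAt_of_lt δ w j (by omega), show j + (i - j) = i by omega]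
      exact hin
    · by_cases hi1 : i + 1 < w.length
      · rw [polyPt_rotateAt_of_lt δ w j (by omega), show j + (i - j + 1) = i + 1 by omega]
        have := hw.dist_polyPt_succ_le hδ (i := i) hi
        linarith [dist_triangle (polyPt δ w (i + 1)) (polyPt δ w i) x, dist_comm (polyPt δ w i) (polyPt δ w (i + 1))]
      · -- `i = n - 1`: vertex `i' + 1 = n - j` is vertex `0 = n = i + 1`
        rw [polyPt_rotateAt_of_le δ w hj (by omega) (by omega), show i - j + 1 - (w.length - j) = 0 by omega, h0n,
          show w.length = i + 1 by omega]
        have := hw.dist_polyPt_succ_le hδ (i := i) hi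
        linarith [dist_triangle (polyPt δ w (i + 1)) (polyPt δ w i) x, dist_comm (polyPt δ w i) (polyPt δ w (i + 1))]
  · -- `i < j`: `i' = i + (n - j)`, in the second stretch
    push Not at hij
    have hgoal2 : 3 ≤ j - i := by
      by_contra h
      have h1 := hw.dist_polyPt_le_mul hδ hij.le hj
      have h2 : ((j - i : ℕ) : ℝ) ≤ 2 := by exact_mod_cast (by omega : j - i ≤ 2)
      nlinarith
    refine ⟨i + (w.length - j), ?_, by omega, ?_, hv1, hvn, ?_⟩
    · by_contra h
      have h1 := hw.dist_polyPt_le_mul_cyclic hδ hj hi.le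
      have h2 : ((w.length - j + i : ℕ) : ℝ) ≤ 1 := by exact_mod_cast (by omega : w.length - j + i ≤ 1)
      rw [dist_comm] at hfar
      nlinarith
    · rw [polyPt_rotateAt_of_le δ w hj (by omega) (by omega), show i + (w.length - j) - (w.length - j) = i by omega]
      exact hin
    · rw [polyPt_rotateAt_of_le δ w hj (by omega) (by omega), show i + (w.length - j) + 1 - (w.length - j) = i + 1 by omega]
      have := hw.dist_polyPt_succ_le hδ (i := i) hi
      linarith [dist_triangle (polyPt δ w (i + 1)) (polyPt δ w i) x, dist_comm (polyPt δ w i) (polyPt δ w (i + 1))]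

end OneLoop

/-! ### Two crossing loops -/

/-- **Two interface loops with disjoint traces, both crossing a round shell, force four
alternating arms (cluster form).** Let `w₁, w₂` be interface loops of `ω` at mesh `δ` with
disjoint traces, each trace meeting both `{|z| ≤ ρ}` and `{|z| ≥ R}`. If `0 < q₁`,
`ρ + 8δ ≤ q₁`, `q₁ + 40δ ≤ q₂`, `q₂ + 8δ ≤ R`, then `ω ∈ altFourArm r₁ r₂` for all hexagonal radii
`r₁ ≤ r₂` with `q₁ + 9δ ≤ (√3/2) δ r₁`, `δ r₂ ≤ q₂ - 9δ`. Proof: rebase each loop at a vertex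
beyond `R - 2δ` (`exists_vertexTraversals_rotateAt`, same trace `polyTrace_rotateAt`, again an
interface loop `IsSiteInterfaceLoop.rotateAt`), getting two separated vertex traversals per loop,
and apply `mem_altFourArm_of_vertexTraversals`. [cite: SmirnovWernerMRL2001, §4 Remark 6 and (15)] [cite: GarbanPeteSchramm2013Pivotal, §2.4] [cite: AizenmanBurchardDuke1999, Appendix A] -/
theorem mem_altFourArm_of_two_crossing_traces {ω : SiteConfig (Site 2)} {f₁ f₂ : HexVertex}
    {w₁ : hexGraph.Walk f₁ f₁} {w₂ : hexGraph.Walk f₂ f₂} (hw₁ : IsSiteInterfaceLoop ω w₁) (hw₂ : IsSiteInterfaceLoop ω w₂)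
    {δ : ℝ} (hδ : 0 < δ) (hdis : Disjoint (polyTrace δ w₁) (polyTrace δ w₂))
    {ρ R q₁ q₂ : ℝ} (hq₁ : 0 < q₁) (hρq : ρ + 8 * δ ≤ q₁) (hgap : q₁ + 40 * δ ≤ q₂) (hqR : q₂ + 8 * δ ≤ R)
    (h₁in : ∃ z ∈ polyTrace δ w₁, ‖z‖ ≤ ρ) (h₁out : ∃ z ∈ polyTrace δ w₁, R ≤ ‖z‖)
    (h₂in : ∃ z ∈ polyTrace δ w₂, ‖z‖ ≤ ρ) (h₂out : ∃ z ∈ polyTrace δ w₂, R ≤ ‖z‖)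
    {r₁ r₂ : ℕ} (hr₁ : q₁ + 9 * δ ≤ Real.sqrt 3 / 2 * (δ * r₁)) (hr₂ : δ * r₂ ≤ q₂ - 9 * δ) (hr : r₁ ≤ r₂) :
    ω ∈ altFourArm r₁ r₂ := by
  -- vertices near the trace points
  have key : ∀ {f : HexVertex} {w : hexGraph.Walk f f} (hw : IsSiteInterfaceLoop ω w),
      (∃ z ∈ polyTrace δ w, ‖z‖ ≤ ρ) → (∃ z ∈ polyTrace δ w, R ≤ ‖z‖) →
      ∃ i j, i ≤ w.length ∧ 1 ≤ j ∧ j ≤ w.length ∧ dist (polyPt δ w i) 0 ≤ ρ + 2 * δ ∧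
        R - 2 * δ ≤ dist (polyPt δ w j) 0 := by
    intro f w hw hin hout
    obtain ⟨z, hz, hzρ⟩ := hin
    obtain ⟨z', hz', hz'R⟩ := hout
    obtain ⟨i, hi, hdi⟩ := hw.exists_polyPt_dist_le_of_mem_polyTrace hδ hz
    obtain ⟨j, hj, hdj⟩ := hw.exists_polyPt_dist_le_of_mem_polyTrace hδ hz'
    have h0n : polyPt δ w 0 = polyPt δ w w.length := by
      rw [polyPt, polyPt, SimpleGraph.Walk.getVert_zero, SimpleGraph.Walk.getVert_length]
    -- index `j ≥ 1` (vertex `0` is vertex `n`)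
    obtain ⟨j', hj'1, hj'n, hj'⟩ : ∃ j', 1 ≤ j' ∧ j' ≤ w.length ∧ polyPt δ w j' = polyPt δ w j := by
      rcases Nat.eq_zero_or_pos j with rfl | hj0
      · exact ⟨w.length, by omega, le_rfl, h0n.symm⟩
      · exact ⟨j, hj0, hj.le, rfl⟩
    refine ⟨i, j', hi.le, hj'1, hj'n, ?_, ?_⟩
    · rw [dist_zero_right]
      have := norm_le_norm_add_norm_sub' (polyPt δ w i) z
      rw [← dist_eq_norm, dist_comm] at this
      linarith
    · rw [hj', dist_zero_right]
      have := norm_le_norm_add_norm_sub' z' (polyPt δ w j)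
      rw [← dist_eq_norm] at this
      linarith
  obtain ⟨i₁, j₁, hi₁, hj₁1, hj₁, hin₁, hout₁⟩ := key hw₁ h₁in h₁out
  obtain ⟨i₂, j₂, hi₂, hj₂1, hj₂, hin₂, hout₂⟩ := key hw₂ h₂in h₂out
  have hρR : ρ + 2 * δ + 4 * δ < R - 2 * δ := by linarith
  obtain ⟨a₁, ha₁2, ha₁n, hA₁, hB₁, hC₁, hD₁⟩ := hw₁.exists_vertexTraversals_rotateAt hδ hρR hi₁ hj₁1 hj₁ hin₁ hout₁
  obtain ⟨a₂, ha₂2, ha₂n, hA₂, hB₂, hC₂, hD₂⟩ := hw₂.exists_vertexTraversals_rotateAt hδ hρR hi₂ hj₂1 hj₂ hin₂ hout₂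
  -- the two rebased loops, as a family over `Bool`
  let f : Bool → HexVertex := fun c ↦ Bool.rec (w₂.getVert j₂) (w₁.getVert j₁) c
  let w : ∀ c, hexGraph.Walk (f c) (f c) :=
    fun c ↦ Bool.rec (motive := fun c ↦ hexGraph.Walk (f c) (f c)) (w₂.rotateAt j₂) (w₁.rotateAt j₁) c
  have hw : ∀ c, IsSiteInterfaceLoop ω (w c) := fun c ↦ by
    cases c; exacts [hw₂.rotateAt hj₂1 hj₂, hw₁.rotateAt hj₁1 hj₁]
  have hlen : ∀ c, (w c).length = Bool.rec w₂.length w₁.length c := fun c ↦ by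
    cases c; exacts [SimpleGraph.Walk.length_rotateAt w₂ hj₂, SimpleGraph.Walk.length_rotateAt w₁ hj₁]
  have htr : ∀ c, polyTrace δ (w c) = Bool.rec (polyTrace δ w₂) (polyTrace δ w₁) c := fun c ↦ by
    cases c; exacts [polyTrace_rotateAt δ w₂ hj₂, polyTrace_rotateAt δ w₁ hj₁]
  -- vertex data: two traversals per loop
  refine mem_altFourArm_of_vertexTraversals hδ hq₁ (ρ := ρ + 4 * δ) (R := R - 4 * δ) (by linarith) hgap (by linarith)
    (w := w) hw (fun c c' h ↦ ?_) (fun _ ↦ 2) (by simp)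
    (fun c ↦ Bool.rec (motive := fun _ ↦ Fin 2 → ℕ) ![1, a₂ + 1] ![1, a₁ + 1] c)
    (fun c ↦ Bool.rec (motive := fun _ ↦ Fin 2 → ℕ) ![a₂, w₂.length - 1] ![a₁, w₁.length - 1] c)
    (fun c i ↦ ?_) (fun c i ↦ ?_) (fun c i ↦ ?_) (fun c i ↦ ?_) (fun c i i' hii' ↦ ?_) hr₁ hr₂ hr
  · rw [htr, htr]
    cases c <;> cases c'
    · exact absurd rfl h
    · exact hdis.symm
    · exact hdis
    · exact absurd rfl h
  · cases c <;> dsimp only <;> fin_cases i <;> simp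
  · cases c <;> dsimp only <;> fin_cases i <;> simp <;> omega
  · rw [hlen]; cases c <;> dsimp only <;> fin_cases i <;> simp <;> omega
  · have hWf : polyPt δ (w false) = polyPt δ (w₂.rotateAt j₂) := rfl
    have hWt : polyPt δ (w true) = polyPt δ (w₁.rotateAt j₁) := rfl
    cases c <;> dsimp only <;> fin_cases i
    · right; rw [hWf]; simp
      rw [← dist_zero_right, ← dist_zero_right]; exact ⟨by linarith, by linarith⟩
    · left; rw [hWf]; simp
      rw [← dist_zero_right, ← dist_zero_right]; exact ⟨by linarith, by linarith⟩
    · right; rw [hWt]; simp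
      rw [← dist_zero_right, ← dist_zero_right]; exact ⟨by linarith, by linarith⟩
    · left; rw [hWt]; simp
      rw [← dist_zero_right, ← dist_zero_right]; exact ⟨by linarith, by linarith⟩
  · cases c <;> dsimp only at hii' ⊢ <;> fin_cases i <;> fin_cases i' <;> simp at hii' ⊢

/-- **Two interface loops with disjoint traces, each traversing the shell once in time, force
four alternating arms** (the form with Aizenman–Burchard traversals, one per loop).
[cite: SmirnovWernerMRL2001, §4 Remark 6 and (15)] [cite: AizenmanBurchardDuke1999, Appendix A] -/
theorem mem_altFourArm_of_hasTraversals_one_one {ω : SiteConfig (Site 2)} {f₁ f₂ : HexVertex}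
    {w₁ : hexGraph.Walk f₁ f₁} {w₂ : hexGraph.Walk f₂ f₂} (hw₁ : IsSiteInterfaceLoop ω w₁) (hw₂ : IsSiteInterfaceLoop ω w₂)
    {δ : ℝ} (hδ : 0 < δ) (hdis : Disjoint (polyTrace δ w₁) (polyTrace δ w₂))
    {ρ R q₁ q₂ : ℝ} (hq₁ : 0 < q₁) (hρq : ρ + 8 * δ ≤ q₁) (hgap : q₁ + 40 * δ ≤ q₂) (hqR : q₂ + 8 * δ ≤ R)
    (h₁ : (hexLoopCurve δ w₁).HasTraversals 1 0 ρ R) (h₂ : (hexLoopCurve δ w₂).HasTraversals 1 0 ρ R)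
    {r₁ r₂ : ℕ} (hr₁ : q₁ + 9 * δ ≤ Real.sqrt 3 / 2 * (δ * r₁)) (hr₂ : δ * r₂ ≤ q₂ - 9 * δ) (hr : r₁ ≤ r₂) :
    ω ∈ altFourArm r₁ r₂ := by
  have key : ∀ {f : HexVertex} {w : hexGraph.Walk f f} (hw : IsSiteInterfaceLoop ω w),
      (hexLoopCurve δ w).HasTraversals 1 0 ρ R →
      (∃ z ∈ polyTrace δ w, ‖z‖ ≤ ρ) ∧ (∃ z ∈ polyTrace δ w, R ≤ ‖z‖) := by
    intro f w hw h
    obtain ⟨s, t, hst, -⟩ := h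
    have hlen : 0 < w.length := by have := hw.three_le_length; omega
    have hmem : ∀ u : I, hexLoopCurve δ w u ∈ polyTrace δ w := fun u ↦
      range_toCurve_subset_polyTrace hlen ⟨u, rfl⟩
    rcases (hst 0).2 with ⟨h1, h2⟩ | ⟨h1, h2⟩ <;> rw [dist_zero_right] at h1 h2
    · exact ⟨⟨_, hmem _, h1⟩, _, hmem _, h2⟩
    · exact ⟨⟨_, hmem _, h2⟩, _, hmem _, h1⟩
  obtain ⟨h₁in, h₁out⟩ := key hw₁ h₁
  obtain ⟨h₂in, h₂out⟩ := key hw₂ h₂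
  exact mem_altFourArm_of_two_crossing_traces hw₁ hw₂ hδ hdis hq₁ hρq hgap hqR h₁in h₁out h₂in h₂out hr₁ hr₂ hr

end Literature.Probability.Percolation
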